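import Summits.KontsevichZagierPeriods.KontsevichZagierPeriods.Theorems.RootDecompRationalCubeDichotomyArctanFibreP7

/-!
# Arctan-fibre calculus for `RationalCubePiKernelSingle` (route `RootDecompRationalCubeDichotomy`, crux stmt-KontsevichZagierPeriods-26322) at `m = 2` · part 8/9

Cell `decomp-kz`, lens 2 (decomp-kz-lens-2 g7): the GENERIC (arctan-fibre) side of the first open rung `m = 2` of
`RationalCubePiKernelSingle` decided INSIDE the Kontsevich–Zagier calculus with `N = 0`, by rules 1+2 only: fibred Möbius
charts `x ↦ x(q+r)/(q+rx)` (`MoebiusData.rel`), the TANGENT-ADDITION chart `x ↦ x(1−p)/(1−px²)` = the group law of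
`tan` as a move (`TanData.tan_add`), Serret's base involution `y ↦ (1−y)/(1+y)` (`rel_serret`), one moving-centre
dissection with null surgery (§8), odd-symmetry vanishing (§7b).  Decided census classes: `π·log 2` (`pilog2_rel`,
census pair #33), Catalan (`catalan_rel`, #32), dilogarithm classes `dilogA_rel` (#28), `dilogB_rel` (#30),
`dilogC_rel` (#24), seven moment relations; §9 the LITERAL binder instances of `RationalCubePiKernelSingle` at
`m = 2`, `N = 0` (the route decl is not referenced by name, so these modules do not import the route file);
§10 six UNIFORM CLASSES `single_classSwap/Reflect/Halve/Moebius/Serret/TanAdd`.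

Source: `HOME/decomp-kz-lens-2/g7/ArctanFibreCalculus.lean` sha256 964497cf335d1c59 (2144 l; critic decomp-kz-crit-1 g2
CLEARED 2026-08-30T09:13:02Z incl. transcription numerics, std axioms), split into 9 modules by the landing seat
decomp-kz-census-1 g7 (contexts re-opened per part; generic docstrings added where the source had none).
No `sorry`; standard axioms.  References: [cite: KontsevichZagier2001, §1.2]; J.-A. Serret (1844).
-/

noncomputable section

open Set MeasureTheory MvPolynomial
open Literature.ModelTheory.ExponentialFields (IsSemialgebraic)
open Literature.NumberTheory.Transcendental
open Literature.NumberTheory.Transcendental.KZ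
open Literature.NumberTheory.Transcendental.KZ.RFun
open Summit.KontsevichZagierPeriods.KontsevichZagierPeriods.Theorems

namespace Summit.KontsevichZagierPeriods.RootDecompRationalCubeDichotomy.ArctanFibre

-- PRIVATE copy (landed twin in farm-unbuilt LinRed module; dedup.landed): volume_setOf_zero_eq
/-- The face `y = c` of the square is null. -/
private theorem volume_setOf_zero_eq (c : ℝ) : volume {z : Fin 2 → ℝ | z 0 = c} = 0 := by
  rw [MeasureTheory.volume_pi]
  exact MeasureTheory.Measure.pi_hyperplane (fun _ : Fin 2 => (volume : Measure ℝ)) 0 c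

-- PRIVATE copy (landed twin elsewhere / dedup.landed): mem_cube_two, snoc_two_zero, snoc_two_one, init_apply_zero, vec_zero, vec_one, rel_constMul
/-- `mem_cube_two`: auxiliary theorem of the arctan-fibre calculus for `RationalCubePiKernelSingle` (stmt-26322) — see the module docstring; verbatim from the lens file. -/
private theorem mem_cube_two {z : Fin 2 → ℝ} (hz : z ∈ KZ.cube 2) :
    (0 ≤ z 0 ∧ z 0 ≤ 1) ∧ (0 ≤ z 1 ∧ z 1 ≤ 1) := ⟨hz 0, hz 1⟩

/-- `snoc_two_zero`: auxiliary theorem of the arctan-fibre calculus for `RationalCubePiKernelSingle` (stmt-26322) — see the module docstring; verbatim from the lens file. -/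
@[simp] private theorem snoc_two_zero (y : Fin 1 → ℝ) (s : ℝ) : (Fin.snoc y s : Fin 2 → ℝ) 0 = y 0 := rfl

/-- `snoc_two_one`: auxiliary theorem of the arctan-fibre calculus for `RationalCubePiKernelSingle` (stmt-26322) — see the module docstring; verbatim from the lens file. -/
@[simp] private theorem snoc_two_one (y : Fin 1 → ℝ) (s : ℝ) : (Fin.snoc y s : Fin 2 → ℝ) 1 = s := rfl

/-- `init_apply_zero`: auxiliary theorem of the arctan-fibre calculus for `RationalCubePiKernelSingle` (stmt-26322) — see the module docstring; verbatim from the lens file. -/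
@[simp] private theorem init_apply_zero (z : Fin 2 → ℝ) : Fin.init z 0 = z 0 := rfl

/-- `vec_zero`: auxiliary theorem of the arctan-fibre calculus for `RationalCubePiKernelSingle` (stmt-26322) — see the module docstring; verbatim from the lens file. -/
@[simp] private theorem vec_zero (a b : ℝ) : (![a, b] : Fin 2 → ℝ) 0 = a := rfl

/-- `vec_one`: auxiliary theorem of the arctan-fibre calculus for `RationalCubePiKernelSingle` (stmt-26322) — see the module docstring; verbatim from the lens file. -/
@[simp] private theorem vec_one (a b : ℝ) : (![a, b] : Fin 2 → ℝ) 1 = b := rfl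

/-- Natural-number multiples: `[c·T] ≡ c • [T]`. -/
private theorem rel_constMul (c : ℕ) (T : RFun 2) :
    KZ.of (((const (c : ℚ)).mul T)).rep - c • KZ.of T.rep ∈ KZ.relations :=
  SoloBlind.of_sub_nsmul_mem_relations c rfl fun x _ => by
    simp only [rep_integrand, fn_mul, fn_const, Rat.cast_natCast]

section Dissection

/-- `D8_pos`: auxiliary theorem of the arctan-fibre calculus for `RationalCubePiKernelSingle` (stmt-26322) — see the module docstring; verbatim from the lens file. -/
private theorem D8_pos {z : Fin 2 → ℝ} (hz : z ∈ bandLoO) : 0 < 1 + z 0 ^ 2 - (1 - z 0) * z 1 := by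
  obtain ⟨⟨hy0, hy1⟩, hx0, hx1⟩ := mem_bandLoO.mp hz
  have hy1' : (0 : ℝ) < 1 - z 0 := by linarith
  nlinarith [mul_le_mul_of_nonneg_left hx1 hy1'.le, sq_nonneg (z 0)]

/-- `π8`: `[A_lo°] ≡ [B°]` by the fibred chart `u = x(1+y)²/((1−y)D)`, `D = 1+y²−(1−y)x`
(`∂u/∂x = (1+y)²(1+y²)/((1−y)D²)`, `D² + x²(1+y)² = (1+y²)Q_A`). -/
theorem ALoO_BO : KZ.of ALoO - KZ.of BO ∈ KZ.relations := by
  have hden : ∀ z ∈ bandLoO, 0 < (1 - z 0) * (1 + z 0 ^ 2 - (1 - z 0) * z 1) := fun z hz => by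
    obtain ⟨⟨-, hy1⟩, -, -⟩ := mem_bandLoO.mp hz
    exact mul_pos (by linarith) (D8_pos hz)
  have haev : ∀ z : Fin 2 → ℝ, aeval z ((1 - X 0) * (1 + X 0 ^ 2 - (1 - X 0) * X 1) : MvPolynomial (Fin 2) ℚ)
      = (1 - z 0) * (1 + z 0 ^ 2 - (1 - z 0) * z 1) := fun z => by simp
  refine KZ.of_sub_of_mem_relations_of_fibreMap (G := Gopen) (a := fun _ => (0 : ℝ)) (b := fA)
    (a' := fun _ => (0 : ℝ)) (b' := fun _ => (1 : ℝ)) ψ8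
    (fun w => (1 + w 0) ^ 2 * (1 + w 0 ^ 2) / ((1 - w 0) * (1 + w 0 ^ 2 - (1 - w 0) * w 1) ^ 2))
    ALoO BO rfl rfl (fun y hy => ?_) ?_ (fun z hz => ?_)
    (fun z hz => ?_) (fun z hz => ?_) (fun y hy => ?_) (fun y hy => ?_) (fun z hz => ?_)
  · obtain ⟨-, hy1⟩ := mem_Gopen_iff.mp hy
    rw [fA_apply]; linarith
  · exact isSemialgebraicFunOn_aeval_div_aeval ALoO.isSemialgebraic_domain _ _ fun z hz => by
      rw [haev]; exact (hden z hz).ne'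
  · have hd : aeval z ((1 - X 0) * (1 + X 0 ^ 2 - (1 - X 0) * X 1) : MvPolynomial (Fin 2) ℚ) ≠ 0 := by
      rw [haev]; exact (hden z hz).ne'
    exact ((Literature.ModelTheory.ExponentialFields.analyticOnNhd_aeval
        (X 1 * (1 + X 0) ^ 2 : MvPolynomial (Fin 2) ℚ) z (mem_univ z)).div
      (Literature.ModelTheory.ExponentialFields.analyticOnNhd_aeval
        ((1 - X 0) * (1 + X 0 ^ 2 - (1 - X 0) * X 1) : MvPolynomial (Fin 2) ℚ) z (mem_univ z))
      hd).differentiableAt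
  · obtain ⟨⟨hy0, hy1⟩, hx0, hx1⟩ := mem_bandLoO.mp hz
    have h1 : (0 : ℝ) < 1 - z 0 := by linarith
    have hD := D8_pos hz
    have hfun : (fun t : ℝ => ψ8 (Fin.snoc (Fin.init z) t)) =
        fun t => t * (1 + z 0) ^ 2 / ((1 - z 0) * (1 + z 0 ^ 2 - (1 - z 0) * t)) := by
      funext t
      rw [snoc_init_eq, ψ8_apply, vec_zero, vec_one]
    rw [hfun]
    have hd := ((hasDerivAt_id (z 1)).mul_const ((1 + z 0) ^ 2)).div
      ((((hasDerivAt_id (z 1)).const_mul (1 - z 0)).const_sub (1 + z 0 ^ 2)).const_mul (1 - z 0))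
      (hden z hz).ne'
    refine hd.congr_deriv ?_
    simp only [id]
    field_simp
    ring
  · obtain ⟨⟨hy0, hy1⟩, hx0, hx1⟩ := mem_bandLoO.mp hz
    have h1 : (0 : ℝ) < 1 - z 0 := by linarith
    have hD := D8_pos hz
    positivity
  · rw [ψ8_apply, snoc_two_zero, snoc_two_one]
    simp
  · obtain ⟨hy0, hy1⟩ := mem_Gopen_iff.mp hy
    have h1 : (0 : ℝ) < 1 - y 0 := by linarith
    have hne : (1 - y 0) * (1 + y 0 ^ 2 - (1 - y 0) * ((1 - y 0) / 2)) ≠ 0 := by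
      have : (0 : ℝ) < 1 + y 0 ^ 2 - (1 - y 0) * ((1 - y 0) / 2) := by nlinarith
      positivity
    rw [ψ8_apply, snoc_two_zero, snoc_two_one, fA_apply, div_eq_one_iff_eq hne]
    ring
  · obtain ⟨⟨hy0, hy1⟩, hx0, hx1⟩ := mem_bandLoO.mp hz
    have h1 : (0 : ℝ) < 1 - z 0 := by linarith
    have hD := D8_pos hz
    have hx1c : z 1 ≤ 1 := by linarith
    have hx1' : (0 : ℝ) ≤ 1 - z 1 := by linarith
    have hQ := cA_pos (show z ∈ KZ.cube 2 from bandLoO_sub hz)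
    show cA.fn z = J1p.fn (Fin.snoc (Fin.init z) (ψ8 z)) *
      ((1 + z 0) ^ 2 * (1 + z 0 ^ 2) / ((1 - z 0) * (1 + z 0 ^ 2 - (1 - z 0) * z 1) ^ 2))
    rw [snoc_init_eq, J1p_fn, vec_zero, vec_one, cA_fn, ψ8_apply]
    have hψ2 : (1 + z 0) ^ 2 + (1 - z 0) ^ 2 *
        (z 1 * (1 + z 0) ^ 2 / ((1 - z 0) * (1 + z 0 ^ 2 - (1 - z 0) * z 1))) ^ 2 =
        (1 + z 0) ^ 2 * ((1 + z 0 ^ 2 - (1 - z 0) * z 1) ^ 2 + z 1 ^ 2 * (1 + z 0) ^ 2) /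
          (1 + z 0 ^ 2 - (1 - z 0) * z 1) ^ 2 := by
      field_simp (disch := first | assumption | positivity |
        (with_unfolding_all (apply ne_of_gt; nlinarith [hD, hQ, h1])))
    have hkey : (1 + z 0 ^ 2 - (1 - z 0) * z 1) ^ 2 + z 1 ^ 2 * (1 + z 0) ^ 2 =
        (1 + z 0 ^ 2) * (1 - 2 * z 1 + 2 * z 1 ^ 2 + 2 * z 1 * z 0 + z 0 ^ 2) := by ring
    rw [hψ2, hkey]
    field_simp (disch := first | assumption | positivity |
      (with_unfolding_all (apply ne_of_gt; nlinarith [hD, hQ, h1])))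

/-- `π9`: `[B°] ≡ [J₁']` (adding back the null face `y = 1`). -/
theorem BO_J1p : KZ.of BO - KZ.of J1p.rep ∈ KZ.relations := by
  refine KZ.of_sub_of_mem_relations_of_null BO J1p.rep ?_ ?_ (fun _ _ => rfl)
  · have h : BO.domain \ J1p.rep.domain = ∅ := sdiff_eq_empty.mpr bandBO_sub
    rw [h, measure_empty]
  · refine measure_mono_null (fun z hz => ?_) (volume_setOf_zero_eq 1)
    have h1 : z ∈ KZ.cube 2 := hz.1
    have h2 : z ∉ bandBO := hz.2
    obtain ⟨⟨hy0, hy1⟩, hx0, hx1⟩ := mem_cube_two h1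
    by_contra hne
    exact h2 (mem_bandBO.mpr ⟨⟨hy0, lt_of_le_of_ne hy1 hne⟩, hx0, hx1⟩)

/-- **Dissection**: `[A] ≡ [p₀] + [J₁']`. -/
private theorem cA_p0_J1p : KZ.of cA.rep - KZ.of p0.rep - KZ.of J1p.rep ∈ KZ.relations := by
  convert add_mem (add_mem (add_mem (add_mem (add_mem cA_split AHi_p0) (rel_reflect 1 p0)) ALo_ALoO)
    ALoO_BO) BO_J1p using 1
  abel

/-- `2•[A] ≡ 6•[B]`. -/
private theorem two_cA_six_cBcen : 2 • KZ.of cA.rep - 6 • KZ.of cBcen.rep ∈ KZ.relations := by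
  convert add_mem (add_mem (nsmul_mem cA_p0_J1p 2) two_J1p_p0) three_p0_six_cBcen using 1
  abel

/-- **The `π log 2` class of the census**: `[□, 1/(1−2x+2x²+2xy+y²)] ≡ 3•[□, 1/(1+2x+2y+x²+2xy+2y²)]`
(`3π log 2/8 = 3 · π log 2/8`), by division by `2` in the `ℚ`-vector space `P_KZ^eff`. -/
theorem pilog2_rel : KZ.of cA.rep - 3 • KZ.of cBcen.rep ∈ KZ.relations := by
  refine SoloBlind.mem_relations_of_nsmul_mem (k := 2) two_ne_zero ?_
  convert two_cA_six_cBcen using 1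
  abel

end Dissection

/-! ## 9. The census differences as literal instances of `RationalCubePiKernelSingle` (`N = 0`) -/

section Instances

/-- `A − 3B` (the `π log 2` pair). -/
def dPiLog2 : RFun 2 := cA.sub ((const ((3 : ℕ) : ℚ)).mul cBcen)
/-- `Q₁ − 2Q₂` (the `D1` dilogarithm pair). -/
def dDilogA : RFun 2 := cQ1.sub ((const ((2 : ℕ) : ℚ)).mul cQ2)
/-- `Q₃ − 2Q₄` (the `D2` dilogarithm pair). -/
def dDilogB : RFun 2 := cQ3.sub ((const ((2 : ℕ) : ℚ)).mul cQ4)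
/-- `Q₅ − Q₆` (the `D3` dilogarithm pair). -/
def dDilogC : RFun 2 := cQ5.sub cQ6
/-- `x/Q₃ − 1/Q₄` (a `D2` moment entry against `Q₄`). -/
def dMomQ3 : RFun 2 := mQ3x.sub cQ4
/-- `x/G_a − 1/G_b` (a Catalan moment entry against `G_b`). -/
def dMomGa : RFun 2 := mGax.sub cGb
/-- `G_a − 2G_b` (the Catalan pair). -/
def dCatalan : RFun 2 := cGa.sub ((const ((2 : ℕ) : ℚ)).mul cGb)

/-- `dPiLog2_rel`: auxiliary theorem of the arctan-fibre calculus for `RationalCubePiKernelSingle` (stmt-26322) — see the module docstring; verbatim from the lens file. -/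
theorem dPiLog2_rel : KZ.of dPiLog2.rep ∈ KZ.relations := by
  convert sub_mem (add_mem (rel_sub cA ((const ((3 : ℕ) : ℚ)).mul cBcen)) pilog2_rel)
    (rel_constMul 3 cBcen) using 1
  rw [dPiLog2]; abel

/-- `dDilogA_rel`: auxiliary theorem of the arctan-fibre calculus for `RationalCubePiKernelSingle` (stmt-26322) — see the module docstring; verbatim from the lens file. -/
theorem dDilogA_rel : KZ.of dDilogA.rep ∈ KZ.relations := by
  convert sub_mem (add_mem (rel_sub cQ1 ((const ((2 : ℕ) : ℚ)).mul cQ2)) dilogA_rel)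
    (rel_constMul 2 cQ2) using 1
  rw [dDilogA]; abel

/-- `dDilogB_rel`: auxiliary theorem of the arctan-fibre calculus for `RationalCubePiKernelSingle` (stmt-26322) — see the module docstring; verbatim from the lens file. -/
theorem dDilogB_rel : KZ.of dDilogB.rep ∈ KZ.relations := by
  convert sub_mem (add_mem (rel_sub cQ3 ((const ((2 : ℕ) : ℚ)).mul cQ4)) dilogB_rel)
    (rel_constMul 2 cQ4) using 1
  rw [dDilogB]; abel

/-- `dDilogC_rel`: auxiliary theorem of the arctan-fibre calculus for `RationalCubePiKernelSingle` (stmt-26322) — see the module docstring; verbatim from the lens file. -/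
theorem dDilogC_rel : KZ.of dDilogC.rep ∈ KZ.relations := by
  convert add_mem (rel_sub cQ5 cQ6) dilogC_rel using 1
  rw [dDilogC]; abel

/-- `dMomQ3_rel`: auxiliary theorem of the arctan-fibre calculus for `RationalCubePiKernelSingle` (stmt-26322) — see the module docstring; verbatim from the lens file. -/
theorem dMomQ3_rel : KZ.of dMomQ3.rep ∈ KZ.relations := by
  convert add_mem (rel_sub mQ3x cQ4) mQ3x_cQ4 using 1
  rw [dMomQ3]; abel

/-- `dMomGa_rel`: auxiliary theorem of the arctan-fibre calculus for `RationalCubePiKernelSingle` (stmt-26322) — see the module docstring; verbatim from the lens file. -/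
theorem dMomGa_rel : KZ.of dMomGa.rep ∈ KZ.relations := by
  convert add_mem (rel_sub mGax cGb) mGax_cGb using 1
  rw [dMomGa]; abel

/-- `dCatalan_rel`: auxiliary theorem of the arctan-fibre calculus for `RationalCubePiKernelSingle` (stmt-26322) — see the module docstring; verbatim from the lens file. -/
theorem dCatalan_rel : KZ.of dCatalan.rep ∈ KZ.relations := by
  convert sub_mem (add_mem (rel_sub cGa ((const ((2 : ℕ) : ℚ)).mul cGb)) catalan_rel)
    (rel_constMul 2 cGb) using 1
  rw [dCatalan]; abel

/-- **`RationalCubePiKernelSingle` at `(m, P, Q) = (2, dPiLog2.num, dPiLog2.den)`** — binders verbatim;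
`N = 0`. -/
theorem single_instPiLog2 (q : KZ.IntegralRep 2)
    (hdom : q.domain = Set.pi Set.univ (fun _ : Fin 2 => Set.Icc (0 : ℝ) 1))
    (_hQ : ∀ z ∈ Set.pi Set.univ (fun _ : Fin 2 => Set.Icc (0 : ℝ) 1),
      MvPolynomial.aeval z dPiLog2.den ≠ 0)
    (hint : ∀ z ∈ Set.pi Set.univ (fun _ : Fin 2 => Set.Icc (0 : ℝ) 1),
      q.integrand z = MvPolynomial.aeval z dPiLog2.num / MvPolynomial.aeval z dPiLog2.den)
    (_hv : q.value = 0) :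
    ∃ N : ℕ, (fun y : KZ.FormalRep => KZ.of KZ.piRep * y)^[N] (KZ.of q) ∈ KZ.relations :=
  single_of_rel dPiLog2 dPiLog2_rel q hdom hint

/-- `… (2, dDilogA.num, dDilogA.den)`. -/
theorem single_instDilogA (q : KZ.IntegralRep 2)
    (hdom : q.domain = Set.pi Set.univ (fun _ : Fin 2 => Set.Icc (0 : ℝ) 1))
    (_hQ : ∀ z ∈ Set.pi Set.univ (fun _ : Fin 2 => Set.Icc (0 : ℝ) 1),
      MvPolynomial.aeval z dDilogA.den ≠ 0)
    (hint : ∀ z ∈ Set.pi Set.univ (fun _ : Fin 2 => Set.Icc (0 : ℝ) 1),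
      q.integrand z = MvPolynomial.aeval z dDilogA.num / MvPolynomial.aeval z dDilogA.den)
    (_hv : q.value = 0) :
    ∃ N : ℕ, (fun y : KZ.FormalRep => KZ.of KZ.piRep * y)^[N] (KZ.of q) ∈ KZ.relations :=
  single_of_rel dDilogA dDilogA_rel q hdom hint

/-- `… (2, dDilogC.num, dDilogC.den)`. -/
theorem single_instDilogC (q : KZ.IntegralRep 2)
    (hdom : q.domain = Set.pi Set.univ (fun _ : Fin 2 => Set.Icc (0 : ℝ) 1))
    (_hQ : ∀ z ∈ Set.pi Set.univ (fun _ : Fin 2 => Set.Icc (0 : ℝ) 1),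
      MvPolynomial.aeval z dDilogC.den ≠ 0)
    (hint : ∀ z ∈ Set.pi Set.univ (fun _ : Fin 2 => Set.Icc (0 : ℝ) 1),
      q.integrand z = MvPolynomial.aeval z dDilogC.num / MvPolynomial.aeval z dDilogC.den)
    (_hv : q.value = 0) :
    ∃ N : ℕ, (fun y : KZ.FormalRep => KZ.of KZ.piRep * y)^[N] (KZ.of q) ∈ KZ.relations :=
  single_of_rel dDilogC dDilogC_rel q hdom hint

/-- `… (2, dCatalan.num, dCatalan.den)`. -/
theorem single_instCatalan (q : KZ.IntegralRep 2)
    (hdom : q.domain = Set.pi Set.univ (fun _ : Fin 2 => Set.Icc (0 : ℝ) 1))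
    (_hQ : ∀ z ∈ Set.pi Set.univ (fun _ : Fin 2 => Set.Icc (0 : ℝ) 1),
      MvPolynomial.aeval z dCatalan.den ≠ 0)
    (hint : ∀ z ∈ Set.pi Set.univ (fun _ : Fin 2 => Set.Icc (0 : ℝ) 1),
      q.integrand z = MvPolynomial.aeval z dCatalan.num / MvPolynomial.aeval z dCatalan.den)
    (_hv : q.value = 0) :
    ∃ N : ℕ, (fun y : KZ.FormalRep => KZ.of KZ.piRep * y)^[N] (KZ.of q) ∈ KZ.relations :=
  single_of_rel dCatalan dCatalan_rel q hdom hint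

/-- `… (2, dDilogB.num, dDilogB.den)` (class `D2`). -/
theorem single_instDilogB (q : KZ.IntegralRep 2)
    (hdom : q.domain = Set.pi Set.univ (fun _ : Fin 2 => Set.Icc (0 : ℝ) 1))
    (_hQ : ∀ z ∈ Set.pi Set.univ (fun _ : Fin 2 => Set.Icc (0 : ℝ) 1),
      MvPolynomial.aeval z dDilogB.den ≠ 0)
    (hint : ∀ z ∈ Set.pi Set.univ (fun _ : Fin 2 => Set.Icc (0 : ℝ) 1),
      q.integrand z = MvPolynomial.aeval z dDilogB.num / MvPolynomial.aeval z dDilogB.den)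
    (_hv : q.value = 0) :
    ∃ N : ℕ, (fun y : KZ.FormalRep => KZ.of KZ.piRep * y)^[N] (KZ.of q) ∈ KZ.relations :=
  single_of_rel dDilogB dDilogB_rel q hdom hint

/-- `… (2, 1 − 2x, Q₃)` (moment entry of class `D2`). -/
theorem single_instMomQ3odd (q : KZ.IntegralRep 2)
    (hdom : q.domain = Set.pi Set.univ (fun _ : Fin 2 => Set.Icc (0 : ℝ) 1))
    (_hQ : ∀ z ∈ Set.pi Set.univ (fun _ : Fin 2 => Set.Icc (0 : ℝ) 1),
      MvPolynomial.aeval z mQ3odd.den ≠ 0)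
    (hint : ∀ z ∈ Set.pi Set.univ (fun _ : Fin 2 => Set.Icc (0 : ℝ) 1),
      q.integrand z = MvPolynomial.aeval z mQ3odd.num / MvPolynomial.aeval z mQ3odd.den)
    (_hv : q.value = 0) :
    ∃ N : ℕ, (fun y : KZ.FormalRep => KZ.of KZ.piRep * y)^[N] (KZ.of q) ∈ KZ.relations :=
  single_of_rel mQ3odd mQ3odd_rel q hdom hint

/-- `… (2, y − x, Q₃)` (moment entry of class `D2`). -/
theorem single_instMomQ3anti (q : KZ.IntegralRep 2)
    (hdom : q.domain = Set.pi Set.univ (fun _ : Fin 2 => Set.Icc (0 : ℝ) 1))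
    (_hQ : ∀ z ∈ Set.pi Set.univ (fun _ : Fin 2 => Set.Icc (0 : ℝ) 1),
      MvPolynomial.aeval z mQ3anti.den ≠ 0)
    (hint : ∀ z ∈ Set.pi Set.univ (fun _ : Fin 2 => Set.Icc (0 : ℝ) 1),
      q.integrand z = MvPolynomial.aeval z mQ3anti.num / MvPolynomial.aeval z mQ3anti.den)
    (_hv : q.value = 0) :
    ∃ N : ℕ, (fun y : KZ.FormalRep => KZ.of KZ.piRep * y)^[N] (KZ.of q) ∈ KZ.relations :=
  single_of_rel mQ3anti mQ3anti_rel q hdom hint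

/-- `… (2, dMomQ3.num, dMomQ3.den)` (moment entry `x/Q₃` vs `1/Q₄`). -/
theorem single_instMomQ3 (q : KZ.IntegralRep 2)
    (hdom : q.domain = Set.pi Set.univ (fun _ : Fin 2 => Set.Icc (0 : ℝ) 1))
    (_hQ : ∀ z ∈ Set.pi Set.univ (fun _ : Fin 2 => Set.Icc (0 : ℝ) 1),
      MvPolynomial.aeval z dMomQ3.den ≠ 0)
    (hint : ∀ z ∈ Set.pi Set.univ (fun _ : Fin 2 => Set.Icc (0 : ℝ) 1),
      q.integrand z = MvPolynomial.aeval z dMomQ3.num / MvPolynomial.aeval z dMomQ3.den)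
    (_hv : q.value = 0) :
    ∃ N : ℕ, (fun y : KZ.FormalRep => KZ.of KZ.piRep * y)^[N] (KZ.of q) ∈ KZ.relations :=
  single_of_rel dMomQ3 dMomQ3_rel q hdom hint

end Instances

end Summit.KontsevichZagierPeriods.RootDecompRationalCubeDichotomy.ArctanFibre

end
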